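import Literature.AnabelianGeometry.AbsoluteAnabelian.AbsTopII.TwoTripodNodalDatum
import Literature.AnabelianGeometry.AbsoluteAnabelian.AbsTopII.DPSCIndexDataOfEmbeddingProofs
import Literature.AnabelianGeometry.AbsoluteAnabelian.AbsTopII.DPSCIndexDataOfEmbeddingCuspCyclic
import Literature.AnabelianGeometry.SemiGraphs.ProSigmaCompletionSemidirectTwistedSections
import Literature.AnabelianGeometry.SemiGraphs.ProSigmaCuspInertiaFreeCyclic
import Literature.AnabelianGeometry.SemiGraphs.ProSigmaCompletionSlim
import Literature.AnabelianGeometry.SemiGraphs.ProSigmaFreeFactorCompletion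
import HarnessLib

/-!
# [AbsTopII] Prop 1.3 (i), (iii), (iii)′ at the two-vertex nodal DPSC datum — vertex inertia `I_{v_A} = T`, `I_{v_B} = U`

S. Mochizuki, *Topics in Absolute Anabelian Geometry II* [AbsTopII] (bib `MochizukiAbsTopII2013`; locators =
PDF pages of the kurims manuscript `paper:url-585b8d0ad0d9`), §1 Def 1.2 (ii) p. 10, Prop 1.3 (i), (iii)
p. 11 (proof p. 13); [CombGC] (`MochizukiCombGC2007`) Prop 1.2 (ii) p. 8, Rmk 1.1.3 p. 7.

PROOF-ONLY companion of `AbsTopII/TwoTripodNodalDatum.lean` (abc-iut-f-066 gen 5, row «P13-TWO-VERTEX-NODAL-MODEL»),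
first half.  At the DPSC datum `M.dpsc` of the degenerating 4-pointed sphere (two tripods `v_A`, `v_B` joined
by ONE node, inertia `I ≅ Ẑ^Σ` acting by the Dehn twist; `Π_I = P`, `Π_𝔾 = closure ι(inl Γ_{0,4})`), EVERY `Σ`:

* the PSC inputs of the cell's bridges hold: [CombGC] Prop 1.2 (ii) at two-tripod shape
  (`twoTripod_commensurablyTerminal`) and slimness of the two verticial subgroups (free pro-`Σ` of rank 2,
  `IsProSigmaCompletion.isSlimGroup` + `freeFactor_isProSigmaCompletion`);
* `T_le_Iv` / `U_le_Iv` — the completed section `T = closure ι(inr ℤ)` centralises `Π_{v_A}` and the twisted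
  section `U = closure ι⟨inl (c₁c₂)⁻¹ · inr 1⟩` centralises `Π_{v_B}` («`I_v ↠ I`» at both vertices);
* `prop13iii_dpsc` — **Prop 1.3 (iii) first clause** (`DPSCData.Prop13iii`: `I_v ∩ Π_𝔾 = 1`, `I_v·Π_𝔾 = Π_I`) by
  abc-iut-w5-d226's bridge `prop13iii_ofEmbedding`; hence **`I_{v_A} = T` and `I_{v_B} = U` EXACTLY**
  (`Iv_eq_T`, `Iv_eq_U`: uniqueness of complements above a section, part XI) and both are `≅ Ẑ^Σ`;
* `prop_1_3_iii'_dpsc` — **Prop 1.3 (iii) (rest), INCLUDING the vertex conjunct `D_v ∩ Π_I = I_v × Π_v`** — at this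
  datum `N_{Π_𝔾}(Π_v) = Π_v` IS in the tree (free-factor commensurable terminality), the clause the loop model
  left open — by abc-iut-f-069's bridge `prop_1_3_iii'_ofEmbedding`;
* `prop_1_3_i_dpsc` — **Prop 1.3 (i)** (`I_c ≅ Ẑ^Σ` for the four cusps) by `prop_1_3_i_ofEmbedding` and
  abc-iut-f-066 gen 4's `isFreeProSigmaCyclic_cuspInertia_closure`.

Convention: group theory is carried out with subgroups of `P` (`M.T`, `M.U`, `ι(Π_v) = (Π_v).map ι`); the
transfer to the `DPSCData` vocabulary of `M.dpsc` is definitional.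
HONEST FRAMING: instance at a constructed datum (constructed ≠ geometric); no hypothesis; no side taken on
[IUTchIII] Cor 3.12; typed ≠ proved for the print statements about all stable log curves.
-/

noncomputable section

open scoped Pointwise

namespace Literature.AnabelianGeometry.AbsoluteAnabelian.AbsTopII.TwoTripodNodal.Model

open Literature.AnabelianGeometry.SemiGraphs
open Literature.AnabelianGeometry.SemiGraphs.SemiGraphOfAnabelioids (IsProSigmaCompletion
  isFreeProSigmaCyclic_cuspInertia_closure)
open Literature.AnabelianGeometry.SemiGraphs.SemiGraphOfAnabelioids.IsProSigmaCompletion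
open Literature.AnabelianGeometry.Anabelioids (IsSigmaInteger)
open Literature.AlgebraicGeometry.Frobenioids (IsSlimGroup)
open Literature.GroupTheory.CombinatorialGroupTheory
open Literature.GroupTheory.CombinatorialGroupTheory.PuncturedSurfaceGroup
open _root_.Topology

variable {Sigma : Set ℕ} (M : Model Sigma)

/-! ### Normal forms inside `P` -/

/-- Pushing a closure out of the closed subgroup `Π_𝔾`: `ι(closure K) = closure ι(K)` for `ι : Π_𝔾 ↪ P`.
[cite: MochizukiAbsTopII2013, Def 1.2 (ii) p.10] -/
theorem map_subtype_topologicalClosure (K : Subgroup ↥M.PiG) :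
    (K.topologicalClosure).map M.PiG.subtype = (K.map M.PiG.subtype).topologicalClosure := by
  apply SetLike.coe_injective
  rw [Subgroup.coe_map, Subgroup.topologicalClosure_coe, Subgroup.topologicalClosure_coe, Subgroup.coe_map,
    Subgroup.coe_subtype]
  exact (M.isClosed_PiG.isClosedEmbedding_subtypeVal.closure_image_eq _).symm

/-- `ι ∘ κG = ι ∘ inl` (as homomorphisms into `P`). [cite: MochizukiSemiAnbd2006, Ex. 2.10 p.31] -/
theorem subtype_comp_κG : M.PiG.subtype.comp M.κG =
    M.ι.comp (SemidirectProduct.inl : PuncturedSurfaceGroup 0 4 →* PuncturedSurfaceGroup 0 4 ⋊[M.φ] Multiplicative ℤ) :=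
  MonoidHom.ext fun _ => rfl

/-- `ι(Π_e) = closure ⟨ι(inl (c₁c₂))⟩` inside `P`. [cite: MochizukiAbsTopII2013, Def 1.2 (ii) p.10] -/
theorem nodeGp_map_eq : (M.nodeGp).map M.PiG.subtype =
    (Subgroup.zpowers (M.ι (SemidirectProduct.inl (c 1 * c 2 : PuncturedSurfaceGroup 0 4)))).topologicalClosure := by
  rw [Model.nodeGp, map_subtype_topologicalClosure, Subgroup.map_map, subtype_comp_κG, MonoidHom.map_zpowers,
    MonoidHom.comp_apply]

/-- `ι(Π_{v_A}) = closure ι(inl ⟨c₁, c₁c₂⟩)` inside `P`. [cite: MochizukiAbsTopII2013, Def 1.2 (ii) p.10] -/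
theorem vertGpA_map_eq : (M.vertGpA).map M.PiG.subtype =
    ((Subgroup.closure ({c 1, c 1 * c 2} : Set (PuncturedSurfaceGroup 0 4))).map
      (M.ι.comp SemidirectProduct.inl)).topologicalClosure := by
  rw [Model.vertGpA, map_subtype_topologicalClosure, Subgroup.map_map, subtype_comp_κG]

/-- `ι(Π_{v_B}) = closure ι(inl ⟨c₁c₂, c₃⟩)` inside `P`. [cite: MochizukiAbsTopII2013, Def 1.2 (ii) p.10] -/
theorem vertGpB_map_eq : (M.vertGpB).map M.PiG.subtype =
    ((Subgroup.closure ({c 1 * c 2, c 3} : Set (PuncturedSurfaceGroup 0 4))).map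
      (M.ι.comp SemidirectProduct.inl)).topologicalClosure := by
  rw [Model.vertGpB, map_subtype_topologicalClosure, Subgroup.map_map, subtype_comp_κG]

/-- A vertex of the datum is `v_A` (`down = 0`) or `v_B` (`down = 1`). [cite: MochizukiAbsTopII2013, Ex 1.1 (ii) p.9] -/
theorem vert_cases (hne : Sigma.Nonempty) (hprime : ∀ p ∈ Sigma, p.Prime) (v : (M.dpsc hne hprime).Vert) : v = ⟨(0 : Fin 2)⟩ ∨ v = ⟨(1 : Fin 2)⟩ := by
  rcases v with ⟨v⟩
  fin_cases v
  · exact Or.inl rfl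
  · exact Or.inr rfl

/-- `Π_{v_A}` of the datum is `ι(Π_{v_A})`. [cite: MochizukiAbsTopII2013, Def 1.2 (ii) p.10] -/
theorem vertSub_zero (hne : Sigma.Nonempty) (hprime : ∀ p ∈ Sigma, p.Prime) : (M.dpsc hne hprime).vertSub ⟨(0 : Fin 2)⟩ = (M.vertGpA).map M.PiG.subtype := rfl

/-- `Π_{v_B}` of the datum is `ι(Π_{v_B})`. [cite: MochizukiAbsTopII2013, Def 1.2 (ii) p.10] -/
theorem vertSub_one (hne : Sigma.Nonempty) (hprime : ∀ p ∈ Sigma, p.Prime) : (M.dpsc hne hprime).vertSub ⟨(1 : Fin 2)⟩ = (M.vertGpB).map M.PiG.subtype := rfl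

/-- `Π_e` of the datum is `ι(Π_e)`. [cite: MochizukiAbsTopII2013, Def 1.2 (ii) p.10] -/
theorem nodeSub_eq (hne : Sigma.Nonempty) (hprime : ∀ p ∈ Sigma, p.Prime) (e : (M.dpsc hne hprime).Node) : (M.dpsc hne hprime).nodeSub e = (M.nodeGp).map M.PiG.subtype := rfl

/-! ### Closed subgroups generated inside a centraliser -/

/-- If the generators `f(s)` commute with `t`, so does the closed subgroup they generate.
[cite: MochizukiAbsTopII2013, Prop 1.3 (iii) p.11] -/
theorem closure_map_le_centralizer {Γ' : Type*} [Group Γ'] (f : Γ' →* M.P) (s : Set Γ') (t : M.P)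
    (h : ∀ x ∈ s, f x * t = t * f x) :
    ((Subgroup.closure s).map f).topologicalClosure ≤ Subgroup.centralizer ({t} : Set M.P) := by
  refine Subgroup.topologicalClosure_minimal _ ?_ (Set.isClosed_centralizer _)
  rw [Subgroup.map_le_iff_le_comap, Subgroup.closure_le]
  intro x hx
  rw [SetLike.mem_coe, Subgroup.mem_comap, Subgroup.mem_centralizer_singleton_iff]
  exact h x hx

/-- `φ(1)` fixes the node element `c₁c₂`. [cite: MochizukiAbsTopII2013, Def 1.2 (ii) p.10] -/
theorem twist_node : M.φ (Multiplicative.ofAdd (1 : ℤ)) (c 1 * c 2) = c 1 * c 2 := by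
  rw [map_mul, M.twist_c_one, M.twist_c_two]

/-! ### «`I_v ↠ I`»: the sections centralise the verticial subgroups -/

/-- **`T` centralises `ι(Π_{v_A}) = closure ι(inl ⟨c₁, c₁c₂⟩)`** (the twist fixes `c₁`, `c₂`).
[cite: MochizukiAbsTopII2013, Prop 1.3 (iii) p.11] -/
theorem T_le_centralizer_vertGpA :
    M.T ≤ Subgroup.centralizer (((M.vertGpA).map M.PiG.subtype : Subgroup M.P) : Set M.P) := by
  intro t ht
  rw [Subgroup.mem_centralizer_iff]
  intro y hy
  rw [SetLike.mem_coe, vertGpA_map_eq] at hy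
  have hle := M.closure_map_le_centralizer (M.ι.comp SemidirectProduct.inl)
    ({c 1, c 1 * c 2} : Set (PuncturedSurfaceGroup 0 4)) t (by
      rintro x (rfl | rfl)
      · exact (SemidirectCofinal.centralizes_of_fixed M.φ M.ι M.twist_c_one ht).symm
      · exact (SemidirectCofinal.centralizes_of_fixed M.φ M.ι M.twist_node ht).symm)
  exact Subgroup.mem_centralizer_singleton_iff.mp (hle hy)

/-- **`U` centralises `ι(Π_{v_B}) = closure ι(inl ⟨c₁c₂, c₃⟩)`** (the twist conjugates `c₃` by `c₁c₂` and fixes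
`c₁c₂`). [cite: MochizukiAbsTopII2013, Prop 1.3 (iii) p.11] -/
theorem U_le_centralizer_vertGpB :
    M.U ≤ Subgroup.centralizer (((M.vertGpB).map M.PiG.subtype : Subgroup M.P) : Set M.P) := by
  intro u hu
  rw [Subgroup.mem_centralizer_iff]
  intro y hy
  rw [SetLike.mem_coe, vertGpB_map_eq] at hy
  have hle := M.closure_map_le_centralizer (M.ι.comp SemidirectProduct.inl)
    ({c 1 * c 2, c 3} : Set (PuncturedSurfaceGroup 0 4)) u (by
      rintro x (rfl | rfl)
      · refine (SemidirectCofinal.centralizes_twisted_of_conj M.φ M.ι (δ := (c 1 * c 2)⁻¹) ?_ hu).symm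
        rw [M.twist_node, inv_inv]; group
      · refine (SemidirectCofinal.centralizes_twisted_of_conj M.φ M.ι (δ := (c 1 * c 2)⁻¹) ?_ hu).symm
        rw [M.twist_c_three, inv_inv])
  exact Subgroup.mem_centralizer_singleton_iff.mp (hle hy)

/-- `T ⊆ I_{v_A}` and `U ⊆ I_{v_B}`, in the DPSC vocabulary. [cite: MochizukiAbsTopII2013, Prop 1.3 (iii) p.11] -/
theorem T_le_Iv (hne : Sigma.Nonempty) (hprime : ∀ p ∈ Sigma, p.Prime) : M.T ≤ (M.dpsc hne hprime).Iv ⟨(0 : Fin 2)⟩ := fun _ ht =>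
  ⟨M.T_le_centralizer_vertGpA ht, Subgroup.mem_top _⟩

/-- `U ⊆ I_{v_B}`, in the DPSC vocabulary. [cite: MochizukiAbsTopII2013, Prop 1.3 (iii) p.11] -/
theorem U_le_Iv (hne : Sigma.Nonempty) (hprime : ∀ p ∈ Sigma, p.Prime) : M.U ≤ (M.dpsc hne hprime).Iv ⟨(1 : Fin 2)⟩ := fun _ hu =>
  ⟨M.U_le_centralizer_vertGpB hu, Subgroup.mem_top _⟩

/-! ### The PSC inputs: [CombGC] Prop 1.2 (ii) and slimness at two-tripod shape -/

/-- **[CombGC] Prop 1.2 (ii) for the two-tripod PSC datum** (free-factor commensurable terminality).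
[cite: MochizukiCombGC2007, Prop 1.2(ii) p.8] -/
theorem verticialEdgeLikeCommensurablyTerminal_pscDatum (hne : Sigma.Nonempty) (hprime : ∀ p ∈ Sigma, p.Prime) :
    (M.pscDatum hne hprime).VerticialEdgeLikeCommensurablyTerminal := by
  haveI : CompactSpace ↥M.PiG := isCompact_iff_compactSpace.mp M.isClosed_PiG.isCompact
  obtain ⟨b, hb0, hb1, hb2⟩ := exists_freeGroupBasis_node
  have hV : ∀ v : (M.pscDatum hne hprime).graph.V, v = (0 : Fin 2) ∨ v = (1 : Fin 2) := fun v => by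
    fin_cases v
    · exact Or.inl rfl
    · exact Or.inr rfl
  have hV₁ : (M.pscDatum hne hprime).vertGp (0 : Fin 2) = ((Subgroup.closure (b '' {0, 1})).map M.κG).topologicalClosure := by
    change M.vertGpA = _
    rw [Set.image_pair, hb0, hb1]; rfl
  have hV₂ : (M.pscDatum hne hprime).vertGp (1 : Fin 2) = ((Subgroup.closure (b '' {1, 2})).map M.κG).topologicalClosure := by
    change M.vertGpB = _
    rw [Set.image_pair, hb1, hb2]; rfl
  have hN : ∀ e, (M.pscDatum hne hprime).nodeGp e = ((Subgroup.closure (b '' {1})).map M.κG).topologicalClosure := by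
    intro e
    change M.nodeGp = _
    rw [Set.image_singleton, hb1, ← Subgroup.zpowers_eq_closure]; rfl
  exact (PSCDatum.twoTripod_commensurablyTerminal hne hprime M.κG M.isProSigmaCompletion_κG b
    (M.pscDatum hne hprime) (0 : Fin 2) (1 : Fin 2) hV hV₁ hV₂ hN id (fun _ => rfl) Nat.zero_lt_two).1

/-- Two distinct elements of a free basis do not commute (detected in `S₃`).
[cite: MochizukiSemiAnbd2006, Ex. 2.10 p.31] -/
theorem basis_mul_ne {β Γ : Type*} [Group Γ] [DecidableEq β] (b : FreeGroupBasis β Γ) {i j : β} (hij : i ≠ j) :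
    b i * b j ≠ b j * b i := by
  let σ : β → Equiv.Perm (Fin 3) := fun k => if k = i then Equiv.swap 0 1 else if k = j then Equiv.swap 1 2 else 1
  let h : Γ →* Equiv.Perm (Fin 3) := b.lift σ
  have hb : ∀ k, h (b k) = σ k := fun k => by
    change FreeGroup.lift σ (b.repr (b k)) = σ k
    rw [FreeGroupBasis.repr_apply_coe, FreeGroup.lift_apply_of]
  intro hc
  have := congrArg h hc
  rw [map_mul, map_mul, hb, hb] at this
  simp only [σ, if_pos rfl, if_neg hij.symm] at this
  exact absurd this (by decide)

/-- **The verticial subgroups of the two-tripod datum are slim** (free pro-`Σ` of rank 2: the closure of a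
rank-2 free factor is its pro-`Σ` completion, Ribes–Zalesskii 9.1.12; pro-`Σ` completions of nonabelian free
groups are slim, [AbsAnab] Lem 1.3.1). [cite: MochizukiCombGC2007, Rmk 1.1.3 p.7] -/
theorem isSlimGroup_vertGp_pscDatum (hne : Sigma.Nonempty) (hprime : ∀ p ∈ Sigma, p.Prime) (w : (M.pscDatum hne hprime).graph.V) :
    IsSlimGroup ↥((M.pscDatum hne hprime).vertGp w) := by
  classical
  obtain ⟨b, hb0, hb1, hb2⟩ := exists_freeGroupBasis_node
  haveI : IsFreeGroup (PuncturedSurfaceGroup 0 4) := b.isFreeGroup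
  haveI : CompactSpace ↥M.PiG := isCompact_iff_compactSpace.mp M.isClosed_PiG.isCompact
  have key : ∀ (S : Set (Fin 3)) (i j : Fin 3), i ∈ S → j ∈ S → i ≠ j →
      IsSlimGroup ↥(((Subgroup.closure (b '' S)).map M.κG).topologicalClosure) := by
    intro S i j hi hj hij
    haveI : CompactSpace ↥(((Subgroup.closure (b '' S)).map M.κG).topologicalClosure) :=
      isCompact_iff_compactSpace.mp (Subgroup.isClosed_topologicalClosure _).isCompact
    refine isSlimGroup ?_ (freeFactor_isProSigmaCompletion b S M.isProSigmaCompletion_κG)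
    exact ⟨⟨b i, Subgroup.subset_closure ⟨i, hi, rfl⟩⟩, ⟨b j, Subgroup.subset_closure ⟨j, hj, rfl⟩⟩,
      fun hc => basis_mul_ne b hij (congrArg Subtype.val hc)⟩
  fin_cases w
  · change IsSlimGroup ↥M.vertGpA
    have h := key {0, 1} 0 1 (by simp) (by simp) (by decide)
    rw [Set.image_pair, hb0, hb1] at h
    exact h
  · change IsSlimGroup ↥M.vertGpB
    have h := key {1, 2} 1 2 (by simp) (by simp) (by decide)
    rw [Set.image_pair, hb1, hb2] at h
    exact h

/-- `ι(inr ℤ) = ⟨ι(inr 1)⟩`. [cite: MochizukiSemiAnbd2006, Ex. 2.10 p.31] -/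
theorem map_inr_range_eq_zpowers :
    ((SemidirectProduct.inr : Multiplicative ℤ →* PuncturedSurfaceGroup 0 4 ⋊[M.φ] Multiplicative ℤ).range.map M.ι) =
      Subgroup.zpowers (M.ι (SemidirectProduct.inr (Multiplicative.ofAdd (1 : ℤ)))) := by
  apply le_antisymm
  · rintro _ ⟨_, ⟨n, rfl⟩, rfl⟩
    refine ⟨Multiplicative.toAdd n, ?_⟩
    change M.ι (SemidirectProduct.inr (Multiplicative.ofAdd (1 : ℤ))) ^ Multiplicative.toAdd n = _
    rw [← map_zpow, ← map_zpow, ← ofAdd_zsmul, smul_eq_mul, mul_one, ofAdd_toAdd]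
  · rw [Subgroup.zpowers_le]
    exact ⟨_, ⟨Multiplicative.ofAdd (1 : ℤ), rfl⟩, rfl⟩

/-- `T` is the twisted section with `δ = 1`: `T = closure ⟨ι(inl 1 · inr 1)⟩`. [cite: MochizukiSemiAnbd2006, Ex. 2.10 p.31] -/
theorem T_eq_closure_zpowers : M.T = (Subgroup.zpowers (M.ι (SemidirectProduct.inl (1 : PuncturedSurfaceGroup 0 4) *
    SemidirectProduct.inr (Multiplicative.ofAdd (1 : ℤ))))).topologicalClosure := by
  rw [map_one, one_mul, Model.T, map_inr_range_eq_zpowers]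

/-- `P = Π_𝔾 · T`. [cite: MochizukiAbsTopII2013, Def 1.2 (ii) p.10] -/
theorem PiG_sup_T : M.PiG ⊔ M.T = ⊤ :=
  SemidirectCofinal.closure_inl_sup_closure_inr_eq_top M.φ (P := M.P) M.isProSigmaCompletion.dense

/-- `P = U · Π_𝔾`. [cite: MochizukiAbsTopII2013, Def 1.2 (ii) p.10] -/
theorem U_sup_PiG : M.U ⊔ M.PiG = ⊤ :=
  SemidirectCofinal.closure_zpowers_twisted_sup_closure_inl_eq_top M.φ M.isProSigmaCompletion _

/-- «`I_v ↠ I`» at both vertices: `I_v · Π_𝔾 = Π_I`. [cite: MochizukiAbsTopII2013, Prop 1.3 (iii) p.11] -/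
theorem Iv_sup_PiG_dpsc (hne : Sigma.Nonempty) (hprime : ∀ p ∈ Sigma, p.Prime) (v : (M.dpsc hne hprime).Vert) :
    (M.dpsc hne hprime).Iv v ⊔ (M.dpsc hne hprime).PiG = (M.dpsc hne hprime).PiI := by
  rw [dpsc_PiG]
  refine le_antisymm le_top ?_
  rcases M.vert_cases hne hprime v with rfl | rfl
  · have h : (⊤ : Subgroup M.P) ≤ M.T ⊔ M.PiG := by rw [sup_comm, M.PiG_sup_T]
    exact le_trans h (sup_le_sup_right (M.T_le_Iv hne hprime) _)
  · have h : (⊤ : Subgroup M.P) ≤ M.U ⊔ M.PiG := by rw [M.U_sup_PiG]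
    exact le_trans h (sup_le_sup_right (M.U_le_Iv hne hprime) _)

/-! ### Prop 1.3 (iii), first clause; `I_{v_A} = T`, `I_{v_B} = U` -/

/-- **[AbsTopII] Prop 1.3 (iii), first clause (`DPSCData.Prop13iii`: «`I_v ≅ I`» — `I_v ∩ Π_𝔾 = 1`,
`I_v·Π_𝔾 = Π_I`) HOLDS at the two-vertex nodal datum, no hypothesis** (abc-iut-w5-d226's bridge from
[CombGC] Prop 1.2 (ii) + slimness + «`I_v ↠ I`», all discharged here). [cite: MochizukiAbsTopII2013, Prop 1.3 (iii) p.11] -/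
theorem prop13iii_dpsc (hne : Sigma.Nonempty) (hprime : ∀ p ∈ Sigma, p.Prime) :
    Literature.AnabelianGeometry.AbsoluteAnabelian.DPSCData.Prop13iii (M.dpsc hne hprime).toDPSCData := by
  haveI : CompactSpace ↥M.PiG := isCompact_iff_compactSpace.mp M.isClosed_PiG.isCompact
  exact DPSCData.prop13iii_ofEmbedding (M.pscDatum hne hprime) M.P M.PiG.subtype continuous_subtype_val
    Subtype.val_injective M.isClosed_range_subtype M.normal_range_subtype ⊤ inferInstance le_top
    (M.verticialEdgeLikeCommensurablyTerminal_pscDatum hne hprime) (M.isSlimGroup_vertGp_pscDatum hne hprime)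
    (M.Iv_sup_PiG_dpsc hne hprime)

/-- `I_v ∩ Π_𝔾 = {1}` with `Π_𝔾` spelled as the model's subgroup. [cite: MochizukiAbsTopII2013, Prop 1.3 (iii) p.11] -/
theorem Iv_inf_PiG_eq_bot (hne : Sigma.Nonempty) (hprime : ∀ p ∈ Sigma, p.Prime) (v : (M.dpsc hne hprime).Vert) : (M.dpsc hne hprime).Iv v ⊓ M.PiG = ⊥ := by
  have h := ((M.prop13iii_dpsc hne hprime) v).1
  rw [dpsc_PiG] at h
  exact h

/-- **`I_{v_A} = T`**: the inertia group of `v_A` IS the completed section (a complement of `Π_𝔾` containing the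
section `T` is `T`). [cite: MochizukiAbsTopII2013, Prop 1.3 (iii) p.11] -/
theorem Iv_eq_T (hne : Sigma.Nonempty) (hprime : ∀ p ∈ Sigma, p.Prime) : (M.dpsc hne hprime).Iv ⟨(0 : Fin 2)⟩ = M.T := by
  have hle : (Subgroup.zpowers (M.ι (SemidirectProduct.inl (1 : PuncturedSurfaceGroup 0 4) *
      SemidirectProduct.inr (Multiplicative.ofAdd (1 : ℤ))))).topologicalClosure ≤ (M.dpsc hne hprime).Iv ⟨(0 : Fin 2)⟩ :=
    le_trans (le_of_eq M.T_eq_closure_zpowers.symm) (M.T_le_Iv hne hprime)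
  have h := SemidirectCofinal.eq_closure_zpowers_of_le_of_inf_eq_bot M.φ M.isProSigmaCompletion
    (1 : PuncturedSurfaceGroup 0 4) hle (M.Iv_inf_PiG_eq_bot hne hprime _)
  exact h.trans M.T_eq_closure_zpowers.symm

/-- **`I_{v_B} = U`**: the inertia group of `v_B` IS the twisted section. [cite: MochizukiAbsTopII2013, Prop 1.3 (iii) p.11] -/
theorem Iv_eq_U (hne : Sigma.Nonempty) (hprime : ∀ p ∈ Sigma, p.Prime) : (M.dpsc hne hprime).Iv ⟨(1 : Fin 2)⟩ = M.U :=
  SemidirectCofinal.eq_closure_zpowers_of_le_of_inf_eq_bot M.φ M.isProSigmaCompletion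
    (c 1 * c 2 : PuncturedSurfaceGroup 0 4)⁻¹ (M.U_le_Iv hne hprime) (M.Iv_inf_PiG_eq_bot hne hprime _)

/-- `T ≅ Ẑ^Σ`. [cite: MochizukiAbsTopII2013, Prop 1.3 (iii) p.11] -/
theorem isFreeProSigmaCyclic_T : IsFreeProSigmaCyclic Sigma ↥M.T :=
  SemidirectCofinal.isFreeProSigmaCyclic_closure_inr M.φ M.isProSigmaCompletion

/-- `U ∩ Π_𝔾 = {1}` (through `I_{v_B} = U`). [cite: MochizukiAbsTopII2013, Prop 1.3 (iii) p.11] -/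
theorem U_inf_PiG (hne : Sigma.Nonempty) (hprime : ∀ p ∈ Sigma, p.Prime) : M.U ⊓ M.PiG = ⊥ := by
  have h := M.Iv_inf_PiG_eq_bot hne hprime ⟨(1 : Fin 2)⟩
  rw [Iv_eq_U] at h
  exact h

/-- `U ≅ Ẑ^Σ` (a closed complement of `Π_𝔾`). [cite: MochizukiAbsTopII2013, Prop 1.3 (iii) p.11] -/
theorem isFreeProSigmaCyclic_U (hne : Sigma.Nonempty) (hprime : ∀ p ∈ Sigma, p.Prime) : IsFreeProSigmaCyclic Sigma ↥M.U :=
  SemidirectCofinal.isFreeProSigmaCyclic_of_isCompl M.φ M.isProSigmaCompletion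
    (Subgroup.isClosed_topologicalClosure _) (M.U_inf_PiG hne hprime) M.U_sup_PiG

/-- **`I_v ≅ Ẑ^Σ`** at both vertices. [cite: MochizukiAbsTopII2013, Prop 1.3 (iii) p.11] -/
theorem isFreeProSigmaCyclic_Iv (hne : Sigma.Nonempty) (hprime : ∀ p ∈ Sigma, p.Prime) (v : (M.dpsc hne hprime).Vert) :
    IsFreeProSigmaCyclic (M.dpsc hne hprime).Sigma ↥((M.dpsc hne hprime).Iv v) := by
  rcases M.vert_cases hne hprime v with rfl | rfl
  · rw [Iv_eq_T]; exact M.isFreeProSigmaCyclic_T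
  · rw [Iv_eq_U]; exact M.isFreeProSigmaCyclic_U hne hprime

/-! ### Prop 1.3 (iii) (rest) and Prop 1.3 (i) -/

/-- **[AbsTopII] Prop 1.3 (iii) (rest) AS TYPED (`Prop_1_3_iii'`, F-0299) HOLDS at the two-vertex nodal datum,
no hypothesis — INCLUDING the vertex conjunct «`D_v ∩ Π_I = I_v × Π_v`, `I_v ≅ Ẑ^Σ`»** (abc-iut-f-069's bridge;
inputs: free-factor commensurable terminality, slimness, `I_v ↠ I`, `I_v ≅ Ẑ^Σ`, all discharged above).
[cite: MochizukiAbsTopII2013, Prop 1.3 (iii) p.11] -/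
theorem prop_1_3_iii'_dpsc (hne : Sigma.Nonempty) (hprime : ∀ p ∈ Sigma, p.Prime) :
    Literature.AnabelianGeometry.AbsoluteAnabelian.AbsTopII.DPSCIndexData.Prop_1_3_iii' (M.dpsc hne hprime) := by
  haveI : CompactSpace ↥M.PiG := isCompact_iff_compactSpace.mp M.isClosed_PiG.isCompact
  exact DPSCIndexData.prop_1_3_iii'_ofEmbedding (M.pscDatum hne hprime) M.P M.PiG.subtype continuous_subtype_val
    Subtype.val_injective M.isClosed_range_subtype M.normal_range_subtype ⊤ inferInstance le_top (fun _ => 1)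
    (fun _ => IsSigmaInteger.one _) (M.verticialEdgeLikeCommensurablyTerminal_pscDatum hne hprime)
    (M.isSlimGroup_vertGp_pscDatum hne hprime) (M.Iv_sup_PiG_dpsc hne hprime) (M.isFreeProSigmaCyclic_Iv hne hprime)

/-- **[AbsTopII] Prop 1.3 (i) AS TYPED (`Prop_1_3_i`, F-0297) HOLDS at the two-vertex nodal datum, no
hypothesis**: the four cusp groups are free pro-`Σ`-cyclic (cusp inertia in a pro-`Σ` completion of `Γ_{0,4}`,
abc-iut-f-066 gen 4) and abc-iut-f-069's bridge. [cite: MochizukiAbsTopII2013, Prop 1.3 (i) p.11] -/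
theorem prop_1_3_i_dpsc (hne : Sigma.Nonempty) (hprime : ∀ p ∈ Sigma, p.Prime) :
    Literature.AnabelianGeometry.AbsoluteAnabelian.AbsTopII.DPSCIndexData.Prop_1_3_i (M.dpsc hne hprime) := by
  haveI : CompactSpace ↥M.PiG := isCompact_iff_compactSpace.mp M.isClosed_PiG.isCompact
  have h04 : PuncturedSurfaceGroup.IsHyperbolicType 0 4 := by
    unfold PuncturedSurfaceGroup.IsHyperbolicType; norm_num
  exact DPSCIndexData.prop_1_3_i_ofEmbedding (M.pscDatum hne hprime) M.P M.PiG.subtype continuous_subtype_val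
    Subtype.val_injective M.isClosed_range_subtype M.normal_range_subtype ⊤ inferInstance le_top (fun _ => 1)
    (fun _ => IsSigmaInteger.one _)
    (fun j => isFreeProSigmaCyclic_cuspInertia_closure h04 M.κG M.isProSigmaCompletion_κG j)

end Literature.AnabelianGeometry.AbsoluteAnabelian.AbsTopII.TwoTripodNodal.Model

end
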